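import Summits.BirchSwinnertonDyer.BirchSwinnertonDyer.Theorems.ResidualThetaTransportAtTwoSignedMuVanishingAtTwoPlusSel2
import Summits.BirchSwinnertonDyer.BirchSwinnertonDyer.Theorems.ResidualThetaTransportAtTwoSignedMuSeedAtTwoPlusSplitFiniteness
import Literature.NumberTheory.EllipticCurves.FineSelmerClassGroupCriterion

/-!
# Line `resolvent-elliptic-units` for crux `SignedMuSeedAtTwoPlus` (stmt-BirchSwinnertonDyer-21438) — crux-ideate r1 k2 (g2)

RESOLVENT DESCENT. On the habitat⁺ the residual representation `W[2]` is dihedral, induced from the cubic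
ray-class character `χ_W` of the resolvent field `K_W = ℚ(√Δ_W)` — imaginary quadratic because `Δ_W < 0`, with
`2` INERT because `W` is good supersingular at `2` (`ρ̄(G_{ℚ₂}) = S₃`, inertia `C₃`) — and `Ŵ ⊗ ℤ₄` is the
Lubin–Tate group of `(ℚ₄, −2)` (Honda, `a₂ = 0`). The seed with `A := W` («`Sel⁺(W/ℚ_∞)[2]` finite») follows from
two statements about the `2`-division field `M_W = ℚ(W[2]) = K_W(χ_W)`:
(B1) classical Iwasawa `μ₂ = 0` for the cyclotomic `ℤ₂`-extension of `M_W` — typed W-FREE as `GillardAtTwo`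
(«`μ₂ = 0` for the cyclotomic `ℤ₂`-extension of every finite Galois number field abelian over an imaginary
quadratic subfield»: Gillard 1985 / Oukhaba–Viguié 2016 for `2` split; CLAIMED for `2` inert or ramified by
Kriz arXiv:2002.04767 Cor 4.68 via the elliptic-unit Euler system (Johnson-Leung–Kings 2011 Thm 5.2, all `p`)
and Sinnott's method) plus the Galois bookkeeping `ResolventOfDivisionFieldTwo`;
(B2) `PlusUnitHalfHabitat`: the image of `Sel⁺(W/ℚ_∞)[2]` in `H¹/Sel₀` is finite (K-side: `χ_W`-units with plus
Kummer position at the inert prime have bounded `𝔽₂`-dimension ⟸ Wiles's explicit reciprocity in the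
LT_{(ℚ₄,−2)} tower (= the CM route's residual ER⁺@2) ∧ `μ(Col⁺(ζ_χ)) = 0` for the elliptic unit `ζ_χ`).
GLUE = tree theorems only: Lim 2017 Thm 3.5 at two (named fact, stub `LimAtTwo`) with `L := M_W ≤ ℚ(W[4])`
(2-power index, stub `DivisionTowerTwoFour`) gives Coates–Sujatha (A) at `(W, 2)`; `FineSplit.splitFiniteness`
(p596845) and `signedMuSeedAtTwoPlus_of_sel2Seed` (p580570) give the seed. BSD is not proved by any of this:
stubs 4 and 5 are research statements (one preprint-claimed, one sharing the CM route's registered residual).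
-/

open WeierstrassCurve Literature.NumberTheory.EllipticCurves
open Literature.NumberTheory.EllipticCurves.Kobayashi2003
open Literature.NumberTheory.EllipticCurves.Rank1Residual
open Literature.NumberTheory.IwasawaTheory
open Summit.BirchSwinnertonDyer.BirchSwinnertonDyer.Theses.ResidualThetaTransportAtTwo

noncomputable section

namespace Summit.BirchSwinnertonDyer.BirchSwinnertonDyer.Cruxes.SignedMuSeedAtTwoPlus.ResolventEllipticUnits

/-! ## The two K-side targets in W-language (tree carriers) -/

/-- (B1) Classical `μ = 0` for the cyclotomic `ℤ₂`-extension of the `2`-division field `M_W = ℚ(W[2])`. -/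
def ResolventMuZeroAtTwo (W : WeierstrassCurve ℚ) : Prop :=
  ∀ κM : ZpExtension (W.divisionField 2) 2, κM.IsCyclotomic → ClassicalMuVanishes κM

/-- (B2) at `κ`: the image of `Sel⁺(W/ℚ_∞)[2]` in `H¹(ℚ_∞, W[2^∞]) ⧸ Sel₀(ℚ_∞, W[2^∞])` is finite. -/
def PlusUnitHalfAtTwo (W : WeierstrassCurve ℚ) [W.IsElliptic] (κ : ZpExtension ℚ 2) : Prop :=
  ((QuotientAddGroup.mk' (W.fineSelmerInfty κ)) ''
    {x : W.subgroupH1 2 κ.kerSubgroup | x ∈ signedSelmerInfty W κ 1 ∧ 2 • x = 0}).Finite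

/-! ## Registered stub statements (named `Prop`s; each `stub_*` proves its statement BY NAME) -/

/-- **Stub 1 (size L, literature `_holds`): Lim 2017 Thm 3.5 with Lemma 3.2 at `p = 2`** — the tree's named fact
(Poitou–Tate over `L^{cyc}`, `cd₂` bookkeeping with `μ₄ ⊂ ℚ(E[4])`, descent along the `2`-power extension
`ℚ(E[4])/L`). Shared in substance with line `fine-plus-split` stub 1; one proof serves both. -/
def LimAtTwo : Prop :=
  Lim2017.thm35_at_two_fineSelmerDual_moduleFinite_of_classicalMuVanishes_of_le_divisionField_four

/-- **Stub 2 (size M, Galois theory of division fields): `ℚ(W[2]) ≤ ℚ(W[4])` with `2`-power index** — the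
kernel of `GL₂(ℤ/4) → GL₂(ℤ/2)` is a `2`-group; tree `finrank_divisionField`. -/
def DivisionTowerTwoFour : Prop :=
  ∀ (W : WeierstrassCurve ℚ) [W.IsElliptic],
    W.divisionField 2 ≤ W.divisionField 4 ∧
      ∃ k : ℕ, Module.finrank ℚ (W.divisionField 4) = 2 ^ k * Module.finrank ℚ (W.divisionField 2)

/-- **Stub 3 (size M, the resolvent): on the habitat⁺, `ℚ(W[2])` is a finite Galois extension of `ℚ` containing
an IMAGINARY quadratic field `K` (`= ℚ(√Δ_W)`, imaginary by `Δ_W < 0`) over which it is abelian** (`Gal = S₃`,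
`Gal(ℚ(W[2])/K) = C₃`; `W[2]` irreducible since `#W̃(𝔽₂) = 3` and the `2`-torsion of the height-2 formal group
has valuation `1/3`). -/
def ResolventOfDivisionFieldTwo : Prop :=
  ∀ (W : WeierstrassCurve ℚ) [W.IsElliptic] [W.IsGloballyMinimal], ¬ W.HasCM → W.analyticRank = 0 →
    GoodSS W 2 → W.frobeniusTrace 2 = 0 → W.Δ < 0 →
    FiniteDimensional ℚ (W.divisionField 2) ∧ IsGalois ℚ (W.divisionField 2) ∧
      ∃ K : IntermediateField ℚ (AlgebraicClosure ℚ), K ≤ W.divisionField 2 ∧ Module.finrank ℚ K = 2 ∧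
        IsEmpty (K →+* ℝ) ∧
        ∀ σ τ : (W.divisionField 2) ≃ₐ[ℚ] (W.divisionField 2),
          (∀ x : W.divisionField 2, (x : AlgebraicClosure ℚ) ∈ K → σ x = x) →
          (∀ x : W.divisionField 2, (x : AlgebraicClosure ℚ) ∈ K → τ x = x) → σ * τ = τ * σ

/-- **Stub 4 (size XL, THE ENGINE'S TARGET, W-free): «Gillard at the prime 2» — classical Iwasawa `μ₂ = 0` for
the cyclotomic `ℤ₂`-extension of every finite Galois number field `F ⊂ ℚ̄` that is ABELIAN over an imaginary
quadratic subfield `K`.** For `2` split in `K`: Gillard 1985 (JLK Thm 5.6 is `p ∤ 6`) and Oukhaba–Viguié 2016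
(`p = 2, 3`); for `2` inert or ramified: CLAIMED by Kriz arXiv:2002.04767 Cor 4.68 (elliptic-unit Euler
system at `p = 2` via Johnson-Leung–Kings 2011 Thm 5.2 + Sinnott–Gillard–Robert `μ(Col(ζ)) = 0`,
Thm 4.66/Cor 4.67; preprint, `w_𝔣 = 1`). The trivial-character part is Ferrero–Washington for `K`. -/
def GillardAtTwo : Prop :=
  ∀ (K F : IntermediateField ℚ (AlgebraicClosure ℚ)), K ≤ F → Module.finrank ℚ K = 2 → IsEmpty (K →+* ℝ) →
    FiniteDimensional ℚ F → IsGalois ℚ F →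
    (∀ σ τ : F ≃ₐ[ℚ] F, (∀ x : F, (x : AlgebraicClosure ℚ) ∈ K → σ x = x) →
      (∀ x : F, (x : AlgebraicClosure ℚ) ∈ K → τ x = x) → σ * τ = τ * σ) →
    ∀ κF : ZpExtension F 2, κF.IsCyclotomic → ClassicalMuVanishes κF

/-- **Stub 5 (size XL, research — the unit/plus half on the habitat⁺):** for every cyclotomic `κ` the image of
`Sel⁺(W/ℚ_∞)[2]` in `H¹/Sel₀` is finite. K-side content: the `χ_W`-units of `Mℚ_n` whose Kummer class at the
inert prime lies in the Kobayashi plus line of LT_{(ℚ₄,−2)} have bounded `𝔽₂`-dimension ⟸ Wiles's explicit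
reciprocity law at `2` (de Shalit I §4; Pollack–Rubin Thm 5.1/7.1–7.2 read at `2` = the CM route's ER⁺@2,
crux K2r0) ∧ `μ(Col⁺(ζ_{χ_W})) = 0` (Kriz Thm 4.66-type, inert `2`). -/
def PlusUnitHalfHabitat : Prop :=
  ∀ (W : WeierstrassCurve ℚ) [W.IsElliptic] [W.IsGloballyMinimal], ¬ W.HasCM → W.analyticRank = 0 →
    GoodSS W 2 → W.frobeniusTrace 2 = 0 → W.Δ < 0 → ∀ κ : ZpExtension ℚ 2, κ.IsCyclotomic → PlusUnitHalfAtTwo W κ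

theorem stub_limAtTwo : LimAtTwo := by
  sorry

theorem stub_divisionTowerTwoFour : DivisionTowerTwoFour := by
  sorry

theorem stub_resolventOfDivisionFieldTwo : ResolventOfDivisionFieldTwo := by
  sorry

theorem stub_gillardAtTwo : GillardAtTwo := by
  sorry

theorem stub_plusUnitHalfHabitat : PlusUnitHalfHabitat := by
  sorry

/-! ## Assembly (sorry-free glue) and the registrar theorem -/

/-- GLUE 1 (no sorry): (B1) on the habitat⁺ from the W-free engine target and the resolvent bookkeeping. -/
theorem resolventMuZero_of_gillard (hR : ResolventOfDivisionFieldTwo) (hG : GillardAtTwo) :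
    ∀ (W : WeierstrassCurve ℚ) [W.IsElliptic] [W.IsGloballyMinimal], ¬ W.HasCM → W.analyticRank = 0 →
      GoodSS W 2 → W.frobeniusTrace 2 = 0 → W.Δ < 0 → ResolventMuZeroAtTwo W := by
  intro W _ _ hCM hr hss ha hΔ κM hκM
  obtain ⟨hfd, hgal, K, hKle, hK2, hKim, hab⟩ := hR W hCM hr hss ha hΔ
  exact hG K (W.divisionField 2) hKle hK2 hKim hfd hgal hab κM hκM

/-- GLUE 2 (no sorry): the Sel2-door hypothesis («for every habitat⁺ curve a congruent partner with
`Sel⁺[2]` finite», here with `A := W`) from the five stub STATEMENTS — Lim 2017 at two with `L := ℚ(W[2])`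
and the landed `FineSplit.splitFiniteness` (p596845).  Stated on the door's hypothesis, not on the crux name,
so that `SignedMuSeedAtTwoPlus_of` below is the unique theorem concluding the crux. -/
theorem sel2Seed_of_stubs (h1 : LimAtTwo) (h2 : DivisionTowerTwoFour) (h3 : ResolventOfDivisionFieldTwo)
    (h4 : GillardAtTwo) (h5 : PlusUnitHalfHabitat) :
    ∀ (W : WeierstrassCurve ℚ) [W.IsElliptic] [W.IsGloballyMinimal], ¬ W.HasCM → W.analyticRank = 0 →
      GoodSS W 2 → W.frobeniusTrace 2 = 0 → W.Δ < 0 →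
      ∀ (κ : ZpExtension ℚ 2) (γ : Field.absoluteGaloisGroup ℚ), κ.IsCyclotomic → κ.IsTopGenerator γ →
        {s : signedSelmerInfty W κ 1 | 2 • s = 0}.Finite := by
  intro W _ _ hCM hr hss ha hΔ κ γ hκ hγ
  obtain ⟨hle, hk⟩ := h2 W
  exact Theorems.SignedMuAtTwo.FineSplit.splitFiniteness W κ γ hκ hγ
    (fun κ' hκ' ↦ h1 W (W.divisionField 2) hle hk (resolventMuZero_of_gillard h3 h4 W hCM hr hss ha hΔ) κ' hκ')
    (h5 W hCM hr hss ha hΔ κ hκ)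

/-- **THE SKELETON THEOREM (registrar shape): the crux BY NAME; the unique theorem of this file concluding it;
the only `sorry`s in its closure are the five `stub_*` theorems** (Sel2 door p580570 with `A := W`,
`e := AddEquiv.refl`). -/
theorem SignedMuSeedAtTwoPlus_of :
    Summit.BirchSwinnertonDyer.BirchSwinnertonDyer.Theses.ResidualThetaTransportAtTwo.SignedMuSeedAtTwoPlus := by
  refine Theorems.SignedMuAtTwo.signedMuSeedAtTwoPlus_of_sel2Seed ?_
  intro W _ _ hCM hr hss ha hΔ
  exact ⟨W, ‹_›, ‹_›, hss, ha, ⟨AddEquiv.refl _, fun σ P ↦ rfl⟩, fun κ γ hκ hγ _ ↦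
    sel2Seed_of_stubs stub_limAtTwo stub_divisionTowerTwoFour stub_resolventOfDivisionFieldTwo stub_gillardAtTwo
      stub_plusUnitHalfHabitat W hCM hr hss ha hΔ κ γ hκ hγ⟩

end Summit.BirchSwinnertonDyer.BirchSwinnertonDyer.Cruxes.SignedMuSeedAtTwoPlus.ResolventEllipticUnits

end
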